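import Summits.Langlands.Langlands.Theses.PicardMuOrdinary
import Summits.Langlands.Langlands.Theorems.PicardMuOrdinaryMuOrdinaryFamilyRTDictionary
import Summits.Langlands.Langlands.Theorems.PicardMuOrdinaryIrregularClassicalityTraceLimit
import Literature.NumberTheory.GaloisRepresentations.GaloisRepOfLadicLimit
import Literature.NumberTheory.GaloisRepresentations.CubicResidueSymbol
import Literature.NumberTheory.Automorphic.ReciprocityGLnProofs
import Literature.NumberTheory.Automorphic.AsaiSign
import HarnessLib

/-!
# Route `PicardMuOrdinary`, crux `IrregularClassicality` (stmt-Langlands-13758), line `slope-free-polarized-limit`: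
# the `3`-adic TRACE LIMIT of the tower's avatars

Continuation lead prover-line-stmt-Langlands-13758-c14-0, 2026-08-17 (skeleton r7/r8).  Part 1 of the elimination of the
Picard named fact from the crux (see `PicardMuOrdinaryIrregularClassicalityAvatarLimit.lean` for the assembly).

The exactly `c₀`-polarized tower that W (`stub_polarizationDebt`) outputs and H (`stub_senClassicalityLinked`) consumes
carries Harris–Lan–Taylor–Thorne avatars `r_k : Γ_K → GL₃(ℚ̄₃)`, Galois-compatible with `P_k` off `S₀`
(`IsGaloisCompatibleAt`, normalisation `m = 3`), whose geometric-Frobenius traces are `ι⁻¹(N𝔭 · ΣSat(P_k, 𝔭))`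
(`norm_trace_inv_sub_le_of_compatible`, from the sibling crux's `trace_inv_of_charpoly_eq_arithFrobPolyOfSatake`) and
hence within `3^{-k}` of `ι⁻¹ e(a_𝔭(f) ϖ_𝔭)`, and which kill the inertia groups off `S₀`
(`apply_eq_one_of_compatible`).  With the finite coefficient field `E = ℚ₃(ι⁻¹ e(K))`
(`exists_intermediateField_mem`), the dense set of geometric Frobenii off `S₀` (Chebotarev, `frobenius_dense`) and
Taylor's pseudo-representation argument in trace form (registered stub S1 `stub_traceLimit`, landed p145892),
`exists_avatarLimit` produces a continuous SEMISIMPLE `ρ : Γ_K → GL₃(ℚ̄₃)`, unramified off `S₀`, with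
`tr ρ(Frob_𝔭⁻¹) = ι⁻¹ e(a_𝔭 ϖ_𝔭)` for every `𝔭 ∉ S₀` (the two `3^{-m}` bounds and `m → ∞`).

References: R. Taylor, Duke Math. J. 63 (1991) §1; W. Goldring, J.-S. Koskivirta, Invent. Math. 217 (2019) §11.1;
M. Harris, K.-W. Lan, R. Taylor, J. Thorne, Res. Math. Sci. 3 (2016) Thm. A.
-/

open Literature.NumberTheory.GaloisRepresentations Literature.NumberTheory.Automorphic
open Literature.RepresentationTheory.Semisimple
open scoped Pointwise NumberField
open IsDedekindDomain NumberField Polynomial Filter Topology Field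

-- `Summit.Langlands.Langlands.…` (summit = sub-problem name, D-0017 layout) trips `dupNamespace` on every decl.
set_option linter.dupNamespace false
set_option autoImplicit false

namespace Summit.Langlands.Langlands.Theorems.IrregularClassicality.SlopeFreePolarizedLimit

noncomputable section

/-! ### Step 0: Frobenius bookkeeping for one avatar -/

/-- For an avatar `r` Galois-compatible with `P` at `𝔭` (Harris–Lan–Taylor–Thorne normalisation `m = 3`) and a
Satake parameter `α` of `P` at `𝔭`: `tr r(σ⁻¹) = ι⁻¹(N𝔭 · Σα)` at every arithmetic Frobenius `σ` above `𝔭`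
(`trace_inv_of_charpoly_eq_arithFrobPolyOfSatake`), so the tower's bound `‖ι⁻¹(N𝔭·Σα − e(x))‖ ≤ c` is a bound on
`‖tr r(σ⁻¹) − ι⁻¹ e(x)‖`. -/
theorem norm_trace_inv_sub_le_of_compatible {hcpt : isCompact_glFiniteIntegralLevel 3 (CyclotomicField 3 ℚ)}
    {P : CuspidalAutomorphicRepData 3 (CyclotomicField 3 ℚ) hcpt} {ι : PadicAlgCl 3 ≃+* ℂ}
    {r : FramedGaloisRep (CyclotomicField 3 ℚ) (PadicAlgCl 3) 3} {𝔭 : HeightOneSpectrum (𝓞 (CyclotomicField 3 ℚ))}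
    (hcomp : IsGaloisCompatibleAt P.1 ι r 𝔭) {α : Multiset ℂ} (hα : P.1.HasSatakeParamAt 𝔭 α)
    {x t : ℂ} (ht : t = (𝔭.residueCard : ℂ) * α.sum - x) {c : ℝ} (hc : ‖ι.symm t‖ ≤ c)
    {𝔓 : Ideal (absIntegers (𝓞 (CyclotomicField 3 ℚ)) (CyclotomicField 3 ℚ))} (h𝔓 : 𝔓 ∈ 𝔭.primesAbove)
    {σ : absoluteGaloisGroup (CyclotomicField 3 ℚ)} (hσ : IsArithFrobAt (𝓞 (CyclotomicField 3 ℚ)) σ 𝔓) :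
    ‖FramedRep.trace r σ⁻¹ - ι.symm x‖ ≤ c := by
  have hchar : ((r σ : GL (Fin 3) (PadicAlgCl 3)) : Matrix (Fin 3) (Fin 3) (PadicAlgCl 3)).charpoly =
      arithFrobPolyOfSatake ι 𝔭.residueCard 3 α := (hcomp α hα).2 𝔓 h𝔓 σ hσ
  have htr : FramedRep.trace r σ⁻¹ = ι.symm ((𝔭.residueCard : ℂ) * α.sum) := by
    rw [FramedRep.trace, map_inv]
    exact Cruxes.MuOrdinaryFamilyRT.CharZeroDominance.trace_inv_of_charpoly_eq_arithFrobPolyOfSatake ι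
      𝔭.residueCard α (r σ) hchar
  rw [htr, ← map_sub, ← ht]
  exact hc

/-- Avatars Galois-compatible with `P` at a place carrying a Satake parameter are unramified there. -/
theorem apply_eq_one_of_compatible {hcpt : isCompact_glFiniteIntegralLevel 3 (CyclotomicField 3 ℚ)}
    {P : CuspidalAutomorphicRepData 3 (CyclotomicField 3 ℚ) hcpt} {ι : PadicAlgCl 3 ≃+* ℂ}
    {r : FramedGaloisRep (CyclotomicField 3 ℚ) (PadicAlgCl 3) 3} {𝔭 : HeightOneSpectrum (𝓞 (CyclotomicField 3 ℚ))}
    (hcomp : IsGaloisCompatibleAt P.1 ι r 𝔭) {α : Multiset ℂ} (hα : P.1.HasSatakeParamAt 𝔭 α)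
    {𝔓 : Ideal (absIntegers (𝓞 (CyclotomicField 3 ℚ)) (CyclotomicField 3 ℚ))} (h𝔓 : 𝔓 ∈ 𝔭.primesAbove)
    {τ : absoluteGaloisGroup (CyclotomicField 3 ℚ)} (hτ : τ ∈ 𝔓.inertia (absoluteGaloisGroup (CyclotomicField 3 ℚ))) : r τ = 1 :=
  (hcomp α hα).1 𝔓 h𝔓 τ hτ

/-! ### Step 1: the coefficient field `E = ℚ₃(ι⁻¹ e(K))` -/

/-- There is a finite extension `E/ℚ₃` inside `ℚ̄₃` containing `ι⁻¹(e(K))` (the `ℚ₃`-span of the images of a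
`ℚ`-basis of `K`). -/
theorem exists_intermediateField_mem (ι : PadicAlgCl 3 ≃+* ℂ) (e : (CyclotomicField 3 ℚ) →+* ℂ) :
    ∃ E : IntermediateField ℚ_[3] (PadicAlgCl 3), FiniteDimensional ℚ_[3] E ∧ ∀ x : (CyclotomicField 3 ℚ), ι.symm (e x) ∈ E := by
  classical
  set b := Module.finBasis ℚ (CyclotomicField 3 ℚ) with hb
  set S : Set (PadicAlgCl 3) := Set.range fun i => ι.symm (e (b i)) with hS
  haveI : FiniteDimensional ℚ_[3] (IntermediateField.adjoin ℚ_[3] S) :=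
    IntermediateField.finiteDimensional_adjoin fun x _ =>
      (Algebra.IsAlgebraic.isAlgebraic (R := ℚ_[3]) x).isIntegral
  refine ⟨IntermediateField.adjoin ℚ_[3] S, inferInstance, fun x => ?_⟩
  have hx : x = ∑ i, b.repr x i • b i := (b.sum_repr x).symm
  rw [hx, map_sum, map_sum]
  refine sum_mem fun i _ => ?_
  rw [← IsScalarTower.algebraMap_smul (R := ℚ) (CyclotomicField 3 ℚ) (b.repr x i) (b i), smul_eq_mul, map_mul, map_mul,
    show algebraMap ℚ (CyclotomicField 3 ℚ) (b.repr x i) = ((b.repr x i : ℚ) : (CyclotomicField 3 ℚ)) from rfl, map_ratCast, map_ratCast]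
  refine mul_mem ?_ (IntermediateField.subset_adjoin _ _ ⟨i, rfl⟩)
  have : ((b.repr x i : ℚ) : PadicAlgCl 3) = algebraMap ℚ_[3] (PadicAlgCl 3) ((b.repr x i : ℚ) : ℚ_[3]) := by
    rw [map_ratCast]
  rw [this]
  exact IntermediateField.algebraMap_mem _ _

/-! ### Step 2: the avatar limit (S1) -/

/-- **The trace limit of the avatars.**  From the avatar tower: a continuous semisimple `ρ : Γ_K → GL₃(ℚ̄₃)` killing
every inertia group at places `v ∉ S₀` and with geometric-Frobenius traces `ι⁻¹ e(a_𝔭 ϖ_𝔭)` there. -/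
theorem exists_avatarLimit (f : ℤ[X]) (hcpt : isCompact_glFiniteIntegralLevel 3 (CyclotomicField 3 ℚ))
    (ι : PadicAlgCl 3 ≃+* ℂ) (e : (CyclotomicField 3 ℚ) →+* ℂ) (S₀ : Finset (HeightOneSpectrum (𝓞 (CyclotomicField 3 ℚ))))
    (c₀ : (CyclotomicField 3 ℚ) ≃ₐ[ℚ] (CyclotomicField 3 ℚ)) (ϖ : HeightOneSpectrum (𝓞 (CyclotomicField 3 ℚ)) → 𝓞 (CyclotomicField 3 ℚ))
    (htower : ∀ k : ℕ, ∃ (P : CuspidalAutomorphicRepData 3 (CyclotomicField 3 ℚ) hcpt) (r : FramedGaloisRep (CyclotomicField 3 ℚ) (PadicAlgCl 3) 3),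
      P.1.IsRegularAlgebraic ∧ P.1.IsConjSelfDualAE c₀ ∧
      ∀ 𝔭 ∉ S₀, P.1.IsUnramifiedAt 𝔭 ∧ IsGaloisCompatibleAt P.1 ι r 𝔭 ∧
        ∃ (α : Multiset ℂ) (t : integralClosure ℤ ℂ), P.1.HasSatakeParamAt 𝔭 α ∧
          (t : ℂ) = (𝔭.residueCard : ℂ) * α.sum - e (↑(picardTrace f 𝔭 * ϖ 𝔭)) ∧
          ‖ι.symm (t : ℂ)‖ ≤ ((3 : ℝ)⁻¹) ^ k) :
    ∃ ρ : FramedGaloisRep (CyclotomicField 3 ℚ) (PadicAlgCl 3) 3,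
      (FramedRep.toRepresentation ρ).IsSemisimpleRepresentation ∧
      (∀ 𝔭 ∉ S₀, ρ.IsUnramifiedAt 𝔭 ∧
        ∀ 𝔓 ∈ 𝔭.primesAbove, ∀ τ : absoluteGaloisGroup (CyclotomicField 3 ℚ), IsArithFrobAt (𝓞 (CyclotomicField 3 ℚ)) τ 𝔓 →
          FramedRep.trace ρ τ⁻¹ = ι.symm (e (↑(picardTrace f 𝔭 * ϖ 𝔭)))) := by
  classical
  choose P r _hreg _hcsd hPr using htower
  -- the dense set of geometric Frobenii off `S₀`, the inertia elements off `S₀`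
  set D : Set (absoluteGaloisGroup (CyclotomicField 3 ℚ)) :=
    {g | ∃ v ∉ (S₀ : Set (HeightOneSpectrum (𝓞 (CyclotomicField 3 ℚ)))), ∃ 𝔓 ∈ v.primesAbove, IsArithFrobAt (𝓞 (CyclotomicField 3 ℚ)) g⁻¹ 𝔓}
    with hDdef
  have hD : Dense D := by
    have h := absoluteGaloisGroup.frobenius_dense chebotarev_artinRep_holds (CyclotomicField 3 ℚ)
      (S₀ : Set (HeightOneSpectrum (𝓞 (CyclotomicField 3 ℚ)))) S₀.finite_toSet
    have hpre : D = (fun g : absoluteGaloisGroup (CyclotomicField 3 ℚ) => g⁻¹) ⁻¹'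
        {σ | ∃ v ∉ (S₀ : Set (HeightOneSpectrum (𝓞 (CyclotomicField 3 ℚ)))), ∃ 𝔓 ∈ v.primesAbove, IsArithFrobAt (𝓞 (CyclotomicField 3 ℚ)) σ 𝔓} := rfl
    rw [hpre]
    exact h.preimage (Homeomorph.inv (absoluteGaloisGroup (CyclotomicField 3 ℚ))).isOpenMap
  set I : Set (absoluteGaloisGroup (CyclotomicField 3 ℚ)) :=
    {τ | ∃ v ∉ (S₀ : Set (HeightOneSpectrum (𝓞 (CyclotomicField 3 ℚ)))), ∃ 𝔓 ∈ v.primesAbove, τ ∈ 𝔓.inertia (absoluteGaloisGroup (CyclotomicField 3 ℚ))}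
    with hIdef
  -- the target values on `D`
  have hDex : ∀ g ∈ D, ∃ v : HeightOneSpectrum (𝓞 (CyclotomicField 3 ℚ)), v ∉ S₀ ∧ ∃ 𝔓 ∈ v.primesAbove, IsArithFrobAt (𝓞 (CyclotomicField 3 ℚ)) g⁻¹ 𝔓 := by
    rintro g ⟨v, hv, 𝔓, h𝔓, hg⟩
    exact ⟨v, fun h => hv h, 𝔓, h𝔓, hg⟩
  let vOf : ∀ g ∈ D, HeightOneSpectrum (𝓞 (CyclotomicField 3 ℚ)) := fun g hg => (hDex g hg).choose
  have hvOf : ∀ g (hg : g ∈ D), vOf g hg ∉ S₀ ∧ ∃ 𝔓 ∈ (vOf g hg).primesAbove, IsArithFrobAt (𝓞 (CyclotomicField 3 ℚ)) g⁻¹ 𝔓 :=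
    fun g hg => (hDex g hg).choose_spec
  let t : absoluteGaloisGroup (CyclotomicField 3 ℚ) → PadicAlgCl 3 := fun g =>
    if hg : g ∈ D then ι.symm (e (↑(picardTrace f (vOf g hg) * ϖ (vOf g hg)))) else 0
  obtain ⟨E, hEfin, hE⟩ := exists_intermediateField_mem ι e
  haveI := hEfin
  have htE : ∀ g ∈ D, t g ∈ E := fun g hg => by
    simp only [t, dif_pos hg]
    exact hE _
  -- the two hypotheses of S1
  have hI : ∀ m : ℕ, ∀ τ ∈ I, r m τ = 1 := by
    rintro m τ ⟨v, hv, 𝔓, h𝔓, hτ⟩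
    obtain ⟨-, hcomp, α, tt, hα, -, -⟩ := hPr m v (fun h => hv h)
    exact apply_eq_one_of_compatible hcomp hα h𝔓 hτ
  have hpow : ∀ m : ℕ, ((3 : ℝ)⁻¹) ^ m = ((3 : ℕ) : ℝ) ^ (-(m : ℤ)) := fun m => by
    rw [zpow_neg, zpow_natCast, inv_pow, Nat.cast_ofNat]
  have happ : ∀ m : ℕ, ∀ g ∈ D, ‖FramedRep.trace (r m) g - t g‖ ≤ ((3 : ℕ) : ℝ) ^ (-(m : ℤ)) := by
    intro m g hg
    obtain ⟨hv, 𝔓, h𝔓, hσ⟩ := hvOf g hg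
    obtain ⟨-, hcomp, α, tt, hα, htt, hnorm⟩ := hPr m (vOf g hg) hv
    simp only [t, dif_pos hg]
    rw [← hpow]
    have h := norm_trace_inv_sub_le_of_compatible hcomp hα htt hnorm h𝔓 hσ
    rwa [inv_inv] at h
  obtain ⟨ρ, hss, hρI, happrox, -⟩ :=
    stub_traceLimit (absoluteGaloisGroup (CyclotomicField 3 ℚ)) 3 3 E D hD t htE I r hI happ
  refine ⟨ρ, hss, fun 𝔭 h𝔭 => ⟨fun 𝔓 h𝔓 τ hτ => hρI τ ⟨𝔭, fun h => h𝔭 h, 𝔓, h𝔓, hτ⟩, fun 𝔓 h𝔓 τ hτ => ?_⟩⟩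
  -- the trace at a geometric Frobenius: both `tr r_m(τ⁻¹)` bounds tend to `0`
  have hb : ∀ m : ℕ, ‖FramedRep.trace ρ τ⁻¹ - ι.symm (e (↑(picardTrace f 𝔭 * ϖ 𝔭)))‖ ≤ ((3 : ℕ) : ℝ) ^ (-(m : ℤ)) := by
    intro m
    obtain ⟨-, hcomp, α, tt, hα, htt, hnorm⟩ := hPr m 𝔭 h𝔭
    have h1 := norm_trace_inv_sub_le_of_compatible hcomp hα htt hnorm h𝔓 hτ
    rw [hpow m] at h1
    have h2 := happrox m τ⁻¹
    have e1 : FramedRep.trace ρ τ⁻¹ - ι.symm (e (↑(picardTrace f 𝔭 * ϖ 𝔭))) =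
        (FramedRep.trace (r m) τ⁻¹ - ι.symm (e (↑(picardTrace f 𝔭 * ϖ 𝔭)))) -
          (FramedRep.trace (r m) τ⁻¹ - FramedRep.trace ρ τ⁻¹) := by ring
    rw [e1]
    have nsub : ∀ a b : PadicAlgCl 3, ‖a - b‖ ≤ max ‖a‖ ‖b‖ := fun a b => by
      simpa [sub_eq_add_neg, norm_neg] using IsUltrametricDist.norm_add_le_max a (-b)
    exact (nsub _ _).trans (max_le h1 h2)
  have h0 : ‖FramedRep.trace ρ τ⁻¹ - ι.symm (e (↑(picardTrace f 𝔭 * ϖ 𝔭)))‖ ≤ 0 :=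
    ge_of_tendsto' (LadicLimit.tendsto_zpow_neg_natCast (ℓ := 3)) hb
  rw [← sub_eq_zero, ← norm_le_zero_iff]
  exact h0


/-- **Registered stub `stub_existsAvatarLimit` of the line `slope-free-polarized-limit` (r7b)** — the closed form of
`exists_avatarLimit`. -/
theorem stub_existsAvatarLimit :
    ∀ (f : ℤ[X]) (hcpt : isCompact_glFiniteIntegralLevel 3 (CyclotomicField 3 ℚ))
      (ι : PadicAlgCl 3 ≃+* ℂ) (e : (CyclotomicField 3 ℚ) →+* ℂ) (S₀ : Finset (HeightOneSpectrum (𝓞 (CyclotomicField 3 ℚ))))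
      (c₀ : (CyclotomicField 3 ℚ) ≃ₐ[ℚ] (CyclotomicField 3 ℚ)) (ϖ : HeightOneSpectrum (𝓞 (CyclotomicField 3 ℚ)) → 𝓞 (CyclotomicField 3 ℚ)),
      (∀ k : ℕ, ∃ (P : CuspidalAutomorphicRepData 3 (CyclotomicField 3 ℚ) hcpt) (r : FramedGaloisRep (CyclotomicField 3 ℚ) (PadicAlgCl 3) 3),
        P.1.IsRegularAlgebraic ∧ P.1.IsConjSelfDualAE c₀ ∧
        ∀ 𝔭 ∉ S₀, P.1.IsUnramifiedAt 𝔭 ∧ IsGaloisCompatibleAt P.1 ι r 𝔭 ∧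
          ∃ (α : Multiset ℂ) (t : integralClosure ℤ ℂ), P.1.HasSatakeParamAt 𝔭 α ∧
            (t : ℂ) = (𝔭.residueCard : ℂ) * α.sum - e (↑(picardTrace f 𝔭 * ϖ 𝔭)) ∧
            ‖ι.symm (t : ℂ)‖ ≤ ((3 : ℝ)⁻¹) ^ k) →
      ∃ ρ : FramedGaloisRep (CyclotomicField 3 ℚ) (PadicAlgCl 3) 3,
        (FramedRep.toRepresentation ρ).IsSemisimpleRepresentation ∧
        (∀ 𝔭 ∉ S₀, ρ.IsUnramifiedAt 𝔭 ∧
          ∀ 𝔓 ∈ 𝔭.primesAbove, ∀ τ : absoluteGaloisGroup (CyclotomicField 3 ℚ), IsArithFrobAt (𝓞 (CyclotomicField 3 ℚ)) τ 𝔓 →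
            FramedRep.trace ρ τ⁻¹ = ι.symm (e (↑(picardTrace f 𝔭 * ϖ 𝔭)))) :=
  fun f hcpt ι e S₀ c₀ ϖ htower => exists_avatarLimit f hcpt ι e S₀ c₀ ϖ htower

end

end Summit.Langlands.Langlands.Theorems.IrregularClassicality.SlopeFreePolarizedLimit
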